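import Literature.NumberTheory.EllipticCurves.Rank1Residual.PrintShape
import Literature.NumberTheory.EllipticCurves.Rank1Residual.Predicates
import Literature.NumberTheory.EllipticCurves.Rank1Residual.Typed.X6
import HarnessLib

/-!
# Burungale–Skinner–Tian–Wan (arXiv:2409.01350v2, PREPRINT), Thm. 1.5: the ANNOUNCED `p`-part of BSD at supersingular primes of semistable curves — as an explicitly labelled OPEN hypothesis, and the conditional X6 class theorem

HONEST FRAMING (cell `b2b-bsdres`, run/shared/lean/b2b/bsd-rank1-residual/; harvest seat
`b2b-bsdres-harvest-1`): prove what is provable now; shrink each hard class to its core with data;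
no claim beyond stated classes. The cell deletes COMBINATION-SHAPED residual classes from PUBLISHED
theorems only; an ANNOUNCED preprint may enter only as an explicitly labelled OPEN hypothesis,
NEVER as a theorem; construction-shaped classes are typed, not attempted; this is not "finishing
BSD".

Class X6 of RESIDUAL-CASES §a.2 (`Rank1Residual.ClassX6 W p := GoodSS W p ∧ Semistable W ∧
(5 ≤ p ∨ a_3 = 0)`: good supersingular `p`, `E` semistable; both ranks) is CONSTRUCTION-SHAPED
with an ANNOUNCED discharge (CLASSES.md; referee R5 S1 / R8.3: "BSTW as OPEN binder only"). This
file types that announced discharge exactly as printed, so that the tree records what X6's closure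
is conditional on — the pattern of `KellerYin2024/AnomalousBSD.lean` + `Rank1Residual/ClassX1KellerYin.lean`
for X1a. Nothing here is asserted: ONE `def … : Prop` (an OPEN hypothesis, never to be fed as a
theorem) and theorems taking it as an explicit binder.

Source (read: `paper:arxiv-2409.01350` chunks p0003–p0006 = printed pp. 3–6 of arXiv v2, 2024-09-11 —
Thm. 1.3 p. 3, Rem. 1.4 / Thm. 1.5 p. 4, §1.2.1 display (1.7) p. 6; the held TeX text prints the label of
(1.7) as "(h4)", the PDF prints "(1.7)"; Crossref/zbMATH
2026-08-19: no journal version). A. Burungale, C. Skinner, Y. Tian, X. Wan, *Zeta elements for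
elliptic curves and applications* [BurungaleSkinnerTianWan2024]. Verbatim:

> **Theorem 1.3.** Let `E/ℚ` be a semistable elliptic curve, and `p > 2` a supersingular prime. If
> `p = 3`, suppose that (1.7) holds. Then Kobayashi's [signed main conj., their 1.2] is true, i.e. for
> `∘ ∈ {+, −}`, we have `(𝓛_p^∘(E)) = ξ_Λ(X_∘(E))`. Moreover, the same holds for any quadratic twist
> `E^K := E ⊗ χ_K` for `χ_K` the character associated to a quadratic field extension `K/ℚ` with
> discriminant coprime to `Np` and divisible only by primes of ordinary reduction for `E`.
> **Remark 1.4.** (i) The above theorem was first announced by the fourth-named author in 2014 in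
> [W]. The pertinent parts of this paper supersede the prior announcement, and the proof realises
> the strategy outlined therein. The preprint [W] is no longer intended for publication. (ii) The CM
> case […] was established by Pollack and Rubin [PoRu] in 2004.
> **Theorem 1.5.** Let `E/ℚ` be a semistable elliptic curve, and `p > 2` a supersingular prime. If
> `p = 3`, suppose that (1.7) holds. If `ord_{s=1} L(s, E/ℚ) = r ≤ 1`, then the `p`-part of the BSD
> formula is true, i.e. `|L^{(r)}(1, E/ℚ)/(Ω_E R(E/ℚ))|_p^{−1} = |#Ш(E/ℚ) · ∏_{q∣N} c_q(E/ℚ)|_p^{−1}`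
> for `Ω_E ∈ ℂ^×` the Néron period and `R(E/ℚ)` the regulator. Moreover, the same holds for any
> quadratic twist `E^K` as in Theorem 1.3. The proof of the `r = 1` case is based on the `p`-adic
> Gross–Zagier formula [Ko1].

with (§1.2.1, p. 6) "(1.7)" = "In the supersingular case we assume `a_p(E) := p + 1 − #E(𝔽_p) = 0`"
(p. 3: "this is only an extra condition when `p = 3`"), and (p. 3) `|·|_p` normalised by
`|p|_p = 1/p`.

Transcription of Thm. 1.5 (tree dictionary of `BSDRootNumberSmallConductorProofs` /
`Rank1Residual.Predicates` / `Rank1Residual.PrintShape`): `W` a globally minimal model (so that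
`W.realPeriodRat` is the Néron period `Ω_E` over `E(ℝ)` — BSTW's `Ω_E`; `W.frobeniusTrace p = a_p`);
"semistable" = `Semistable W`; "`p > 2` a supersingular prime" = `p ≠ 2 ∧ GoodSS W p` (good
reduction, `p ∣ a_p`); "(1.7) if `p = 3`" = `p = 3 → W.frobeniusTrace 3 = 0`; "`ord_{s=1} L = r ≤ 1`"
= `W.analyticRank ≤ 1` (then `L^{(r)}(1,E) = r!·W.leadingLCoeff = W.leadingLCoeff`); conclusion =
the cell's NO-TORSION print shape (x11a's `bsdp_of_padicVal_printShape` hypothesis, = the display of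
Skinner 2016 / BSTW): `L^{(r)}(E,1)/(Ω·Reg)` is a rational `q` with
`ord_p q = ord_p #Ш + ord_p ∏ c_ℓ` (`#Ш = W.shaOrder`, finite in analytic rank `≤ 1` by GZK). The
quadratic-twist clause and Thm. 1.3 (signed main conj.; no `±`-Selmer vocabulary in the tree) are
NOT transcribed. -- TODO(general form): the twist clause "E^K, disc(K) coprime to Np, only ordinary
-- primes of E dividing disc(K)" — an announced sub-population of class X7 — once needed.

Then `X6.bsdp_of_thm15_OPEN`: the X6 class statement CONDITIONAL on this OPEN binder (plus GZK and
the hypothesis `Irr W p` — irreducibility of `E[p]` at a supersingular `p > 2` is classical, Serre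
1972 Prop. 12; APPEND harvest seat 1 GEN 8: it IS a tree theorem
(`hasIrreducibleModPGaloisRep_of_dvd_frobeniusTrace`, on the class: `Rank1Residual.ClassX6.irr`), and
the primed versions `X6.bsdp_of_thm15_OPEN'` / `X6.bsdp_of_classX6_of_OPEN'` drop the binder — the
cell's flag `X6-irr-binder` is RETIRED: granted the OPEN binder and GZK, `BSD(E,p)` at EVERY X6 pair
with `p ≠ 2` in analytic rank `≤ 1`, no further hypothesis). STATUS: the binder is
PRE (announced 2024, unrefereed); the rank-one half of X6 is PUB* in the tree WITHOUT it
(`Typed.X6.bsdp_of_analyticRank_eq_one` from JSW 2017 Thm. 1.2.1, whose supersingular input is the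
withdrawn [W] — a caveat that, by Rem. 1.4 (i), only the publication of THIS preprint can lift).

## References
* [BurungaleSkinnerTianWan2024] arXiv:2409.01350v2, Thm. 1.3 (p. 3), Rem. 1.4 / Thm. 1.5 (p. 4), §1.2.1 (1.7)
  (p. 6; TeX label (h4)).
* [Kobayashi2003] S. Kobayashi, Invent. Math. 152 (2003) (signed Selmer groups; the main conj. 1.2 of BSTW).
* [PollackRubin2004] (CM case); [Kobayashi2013] (p-adic Gross–Zagier, the r = 1 input).
* RESIDUAL-CASES.md §a.2 X6; CLASSES.md X6 (R5 S1, R8.3); `Rank1Residual/Typed/X6.lean`.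
-/

set_option autoImplicit false

noncomputable section

open scoped Classical

open WeierstrassCurve Literature.NumberTheory.EllipticCurves
  Literature.NumberTheory.EllipticCurves.Rank1Residual

namespace Literature.NumberTheory.EllipticCurves.BurungaleSkinnerTianWan2024

/-- **OPEN HYPOTHESIS — UNREFEREED PREPRINT (arXiv:2409.01350v2, 2024), Thm. 1.5.** "Let `E/ℚ` be
a semistable elliptic curve, and `p > 2` a supersingular prime. If `p = 3`, suppose that (1.7)
[`a_3 = 0`] holds. If `ord_{s=1} L(s,E/ℚ) = r ≤ 1`, then the `p`-part of the BSD formula is true,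
i.e. `|L^{(r)}(1,E/ℚ)/(Ω_E R(E/ℚ))|_p^{-1} = |#Ш(E/ℚ)·∏_{q∣N} c_q(E/ℚ)|_p^{-1}`." Transcribed for a
globally minimal `W`: `p ≠ 2`, `Semistable W`, `GoodSS W p` (good, `p ∣ a_p`), `p = 3 → a_3 = 0`,
`W.analyticRank ≤ 1` ⇒ the no-torsion print shape (`L^{(r)}(E,1)/(Ω·Reg) = q ∈ ℚ`,
`ord_p q = ord_p #Ш + ord_p ∏ c_ℓ`). The twist clause of the printed theorem is not included.
NEVER cite this `Prop` as a theorem; take it as an explicit hypothesis (the cell's announced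
discharge of class X6; Rem. 1.4 (i): it supersedes Wan's withdrawn preprint [W]).
[claim: BurungaleSkinnerTianWan2024, status: under-review] -/
def thm15_pPart_OPEN : Prop :=
  ∀ (W : WeierstrassCurve ℚ) [W.IsElliptic] [W.IsGloballyMinimal] (p : ℕ) [Fact p.Prime],
    p ≠ 2 → Semistable W → GoodSS W p → (p = 3 → W.frobeniusTrace 3 = 0) →
      W.analyticRank ≤ 1 →
      ∃ q : ℚ, W.leadingLCoeff / ((W.realPeriodRat * W.regulator : ℝ) : ℂ) = (q : ℂ) ∧
        padicValRat p q = (padicValNat p W.shaOrder : ℤ) + padicValNat p W.tamagawaProduct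

/-- On class X6 the printed side condition "(1.7) if `p = 3`" (TeX label (h4)) holds: `ClassX6 W p` carries
`5 ≤ p ∨ a_3 = 0`. Bookkeeping. [cite: Miller2011LMS, Def. 1.1 (shape only; nothing asserted)] -/
theorem h4_of_classX6 (W : WeierstrassCurve ℚ) [W.IsGloballyMinimal] (p : ℕ) [Fact p.Prime]
    (hX : ClassX6 W p) : p = 3 → W.frobeniusTrace 3 = 0 := by
  rintro rfl
  rcases hX.2.2 with h5 | h0
  · omega
  · exact h0

/-- **X6 conditional class theorem (announced discharge as an OPEN binder).** IF the announced
Thm. 1.5 of Burungale–Skinner–Tian–Wan (`hBSTW_OPEN`, unrefereed) holds, then at every X6 pair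
`(E, p)` with `p ≠ 2`, `E[p]` irreducible (`hirr`; automatic at a supersingular `p > 2`, not yet a
tree lemma) and analytic rank `≤ 1`, Miller's `BSD(E,p)` follows — via the cell's bridge
`bsdp_of_padicVal_printShape` (GZK `hGZK` for `rank = r_an` and finiteness of `Ш`). This is a
CONDITIONAL statement recording what X6's closure rests on; it closes nothing.
[claim: BurungaleSkinnerTianWan2024, status: under-review] [cite: Miller2011LMS, §1 and Def. 1.1] -/
theorem X6.bsdp_of_thm15_OPEN (hBSTW_OPEN : thm15_pPart_OPEN)
    (hGZK : rank_eq_analyticRank_of_analyticRank_le_one)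
    (W : WeierstrassCurve ℚ) [W.IsElliptic] [W.IsGloballyMinimal] (p : ℕ) [Fact p.Prime]
    (hp : p ≠ 2) (hX : ClassX6 W p) (hirr : Irr W p) (hr : W.analyticRank ≤ 1) : BSDp W p :=
  bsdp_of_padicVal_printShape W p hGZK hr hirr
    (hBSTW_OPEN W p hp hX.2.1 hX.1 (h4_of_classX6 W p hX) hr)

/-- The same in the canonical binder order of the cell's class theorems
(`… → r_an ≤ 1 → ClassX6 W p → BSDp W p`), for the writer's table.
[claim: BurungaleSkinnerTianWan2024, status: under-review] [cite: Miller2011LMS, §1 and Def. 1.1] -/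
theorem X6.bsdp_of_classX6_of_OPEN (hBSTW_OPEN : thm15_pPart_OPEN)
    (hGZK : rank_eq_analyticRank_of_analyticRank_le_one)
    (W : WeierstrassCurve ℚ) [W.IsElliptic] [W.IsGloballyMinimal] (p : ℕ) [Fact p.Prime]
    (hp : p ≠ 2) (hirr : Irr W p) (hr : W.analyticRank ≤ 1) (hX : ClassX6 W p) : BSDp W p :=
  X6.bsdp_of_thm15_OPEN hBSTW_OPEN hGZK W p hp hX hirr hr

/-! ### APPEND (harvest seat 1 GEN 8): the (irr) binder is automatic — Serre 1972 §1.11 Prop. 12,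
PROVED in the tree; flag `X6-irr-binder` retired -/

/-- **X6 conditional class theorem, NO (irr) binder.** IF the announced Thm. 1.5 of
Burungale–Skinner–Tian–Wan (`hBSTW_OPEN`, unrefereed) holds, then at EVERY X6 pair `(E, p)` with
`p ≠ 2` and analytic rank `≤ 1`, Miller's `BSD(E,p)` follows (GZK `hGZK`); the irreducibility of
`E[p]` that the bridge `bsdp_of_padicVal_printShape` wants is Serre's Prop. 12 at the odd
supersingular prime (`Rank1Residual.ClassX6.irr`). CONDITIONAL; closes nothing.
[claim: BurungaleSkinnerTianWan2024, status: under-review] [cite: Serre1972, §1.11 Prop. 12] [cite: Miller2011LMS, §1 and Def. 1.1] -/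
theorem X6.bsdp_of_thm15_OPEN' (hBSTW_OPEN : thm15_pPart_OPEN)
    (hGZK : rank_eq_analyticRank_of_analyticRank_le_one)
    (W : WeierstrassCurve ℚ) [W.IsElliptic] [W.IsGloballyMinimal] (p : ℕ) [Fact p.Prime]
    (hp : p ≠ 2) (hX : ClassX6 W p) (hr : W.analyticRank ≤ 1) : BSDp W p :=
  X6.bsdp_of_thm15_OPEN hBSTW_OPEN hGZK W p hp hX (ClassX6.irr W p hp hX) hr

/-- The same in the canonical binder order (`… → r_an ≤ 1 → ClassX6 W p → BSDp W p`), NO (irr)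
binder, for the writer's table. [claim: BurungaleSkinnerTianWan2024, status: under-review] [cite: Serre1972, §1.11 Prop. 12] [cite: Miller2011LMS, §1 and Def. 1.1] -/
theorem X6.bsdp_of_classX6_of_OPEN' (hBSTW_OPEN : thm15_pPart_OPEN)
    (hGZK : rank_eq_analyticRank_of_analyticRank_le_one)
    (W : WeierstrassCurve ℚ) [W.IsElliptic] [W.IsGloballyMinimal] (p : ℕ) [Fact p.Prime]
    (hp : p ≠ 2) (hr : W.analyticRank ≤ 1) (hX : ClassX6 W p) : BSDp W p :=
  X6.bsdp_of_thm15_OPEN' hBSTW_OPEN hGZK W p hp hX hr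

end Literature.NumberTheory.EllipticCurves.BurungaleSkinnerTianWan2024
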